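import Mathlib
import HarnessLib
import HarnessLib.Audit
import Summits.NavierStokesRegularity.Statement
import Summits.NavierStokesRegularity.NavierStokesRegularity.Theses.TaoLadderRungTwoBreak
import Literature.Analysis.FluidPDE.Tao2016AveragedNS.ViscousEnvelopeSmoothing
import Literature.Analysis.FluidPDE.Tao2016AveragedNS.ViscousDyadicMemberRegularity

/-!
Route: OrthantWake

DORMANT since 2026-09-03T00:43:27Z (reconciler: no traction for 5 d (last activity statement-checked at 2026-08-29T00:08:37Z); parked, not closed — `ledger route dormant route-NavierStokesRegularity-OrthantWake --off` to reactivate) — unstaffed, not closed; items shared with open routes are served there. `ledger route dormant <id> --off` reactivates.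

# Route OrthantWake — KP networks (orthant tables) cannot cascade at small ε₀ — positive cone +
FORWARD-SOURCE tail-energy BLOCK ratchet ⇒ KP conjunct of rung M2Break (rev 4: block form on KP
networks proper; second declared residual = non-diagonal orthant pocket)

RUNG-LEAF LINE (D-0145 ideator line g3-2 of seat ns-idea-1, technique card «monotone quantity hunt»;
bears_on TL-M2Break;
MODEL LATTICE ODEs ONLY — nothing here is a statement about Navier–Stokes or Clay (A)–(D); no summit
is proved by a line).
It suffices to show X = X_wake ∧ X_cone ∧ X_smooth ∧ X_glue together with the DECLARED RESIDUAL
conjuncts X_res (non-orthant tables, stmt-24640) and X_res2 (non-diagonal orthant pocket,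
NonDiagonalOrthantBreak).
REV 2 (g5, 2026-08-28): the total-energy ratchet OrthantHopWake (stmt-24639) is NUMERICALLY REFUTED
AS TYPED (CENSUS-24639-v3, ns-ow-p1 g2: dead-end side-pocket orthant table T₁₀ ∈ E₂(10) — chain +
in-shell side mode + re-entry + diode-fed DEAD END — has per-hop exponent W = 0.20–0.47 < 1 on the
whole inertial window for ε₀ = 1/2 … 1/64, band lengthening as ν ↓; every R ≥ 4) and stays in the
file as that settled negative (aside). Its repair R1″ keeps the uniform constants (η, κ₁, ε̄ before
ν, α, X₀) and changes the OBSERVABLE: the ratchet is stated for the FORWARD-SOURCE tail energies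
T⁺_n = Σ_(k≥n) Σ_(i∈S) ½X_(i,k)², S ⊇ S⁺(α) = {i : ∃ j l, α i j l (0,0,1) ≠ 0} (ForwardHopWake,
stmt-26438): only μ = (0,0,1) terms of quadTerm move energy up a shell, a two-shell triad with
vanishing (0,0,1) coefficient is a rotor inside the lower shell by (4.2)–(4.3), so diode-parked
dead-end energy is inert for the cascade and is not counted; on exit-complete networks T⁺ = T on fed
modes and every measured W stands. The glue now runs through ForwardSourceSmoothing (stmt-26374,
shared with SubcriticalEnvelope: a subcritical T⁺-envelope already smooths the viscous lattice) and
ForwardBreakOfWake (stmt-26443); OrthantBreakOfWake (stmt-24641, proved for T) leaves the cone as an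
aside.

REV 4 (g5-5, 2026-08-28 ≈09Z): two witnesses retired the rev-2/3 crux ForwardHopWake (stmt-26438) AS
TYPED, and it stays in the file as that settled numerical negative (aside, never reworded): (W1, own
instrument kp_lattice.py, kit j303295/j303489) on ASYMMETRIC 2-CYCLE KP networks {F 0→1 (1), F 1→0
(c)} the PER-HOP exponent of the forward-source tail alternates around the Kolmogorov mean
(constant-flux modulation c_n A_n² A_(n+1) = const puts the standing energy on the weak-exit
parity): W⁺_low = 0.977 (c = 0.8, ε₀ = 1/8), 0.739/0.930 (c = 0.6), 0.629/0.669 (c = 0.5), 0.17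
(Z02, c_w/c_s = 0.23) while every 2-block exponent is ≥ 1.27 — the per-hop form is misstated, the
BLOCK form is clean on 49/49 + 8/8 cascading rows (min 1.233 = the dumbbell value at 1/8); (W2,
idea-crit-3 / ns-ow-p1 g4, exact TWIN EMBEDDING) rotating the dead-end pocket of α_SB / T₁₀ into the
null direction of a non-diagonal rank-one feed form (4x_2 − 3x_3)²/16 makes every mode a syntactic
forward source, so on NON-DIAGONAL orthant tables any syntactic-S⁺ functional equals the total tail
energy and inherits Θ → 5/9, W = 0.20–0.47 (flat in n: every block length fails). REPAIR R1⁗ =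
KPBlockWake: the ratchet per BLOCK of L hops (L = L(R) chosen with η, κ₁, ε̄ BEFORE ε₀, ν, α; factor
(1+ε₀)^(−(1+η)L)) on KP NETWORKS PROPER = orthant tables with DIAGONAL forward feed forms («∀ a b i,
a ≠ b → α a b i (0,0,1) = 0»: every syntactic source self-drains through α_(aai)Λx_a² with orthant
back-reaction; all instrument rows of record lie in this class); glue KPBreakOfBlockWake (block
induction on n₀ + jL ⇒ ν-uniform envelope with constant e^((1+η)κ₁)2^((1+η)(L+1)) ⇒
ForwardSourceSmoothing, stmt-26374, PROVED 07:51Z); the complement of the KP class inside the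
orthant class is the second DECLARED RESIDUAL NonDiagonalOrthantBreak (thin pocket; plan recorded,
not claimed: for orthant tables feed forms are copositive symmetric Z-matrices hence PSD, zero
forward flux ⇔ common kernel N(α), so the basis-free source space V⁺ = N(α)^⊥ plus rotation
covariance of the lattice is the attack). ForwardBreakOfWake (stmt-26443) leaves the cone with its
hypothesis (aside).

OBJECT: call a comparable table α an ORTHANT TABLE ("KP network") when its cascade nonlinearity is
quasi-positive on the
cone of shell configurations that are componentwise ≥ 0 above the datum shell (Kamke condition: X ≥
0 on shells ≥ 1 and
X_(i,n) = 0, n ≥ 1 ⇒ quadTerm_(i,n) ≥ 0); by the cancellation law (4.3) these are exactly the tables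
all of whose
interactions are Katz–Pavlović pairs (x_j² → x_i with back-damping −x_i x_j; inter-shell feeds x_k²
→ x'_i with diagonal
back-damping), the dyadic member being the one-mode case and in-shell chains/circuits the generic
case; Tao's blow-up
tables are NOT orthant (amplifier and rotor gates). THE MONOTONE QUANTITY: for non-negative honest
viscous cascades the
tail energy T_n = Σ_(k≥n) Σ_i ½X_(i,k)² is fed only from below by a non-negative flux, and the crux
X_wake = OrthantHopWake
says that beyond a transient depth κ₁/ε₀ its running maximum ratchets DOWN by a SUPER-CRITICAL
factor per shell,
T_(n+1)(t) ≤ (1+ε₀)^(−(1+η))·max_(u≤t) T_n(u) with η = η(R) > 0, uniformly in ε₀ ≤ ε̄, ν > 0, table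
and datum (each shell
keeps or burns a fixed fraction per unit log-frequency: stalling residue + dissipation). GUIDE TO
THE EXPONENT: in the
base → 1 continuum limit the positive cascade is the conservation law E_τ + (e^(5κ/2)(2E)^(3/2))_κ =
0 (κ = n·ln(1+ε₀));
its entropy front is a second-kind self-similar shock whose smooth sonic transition selects the wake
E ∝ e^(−W₀κ) with
W₀ = 5/3 (Kolmogorov scaling; in BMR's exponent β the same computation gives 2β/3 against the
viscous threshold 2(β−2),
i.e. criticality exactly at Cheskidov's β = 3). MEASURED (j296951, self-similar κ-windows, W_fit =
W_r to 3 digits):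
W(ε₀) = 1.67, 1.56, 1.24, 1.29 (dyadic, ε₀ = ½, ¼, ⅛, 1/16) and 1.59, 1.29, 1.33 (2-chain): the
lattice front is
dispersive, undershoots the entropy value and appears to settle near 1.3 — still super-critical (η ≈
0.3). The ratchet IS
a subcritical tail-energy envelope (T_n ≤ C(1+ε₀)^(−(1+η)n), the transient absorbed in C ≤
E₀e^((1+η)(κ₁+1))), and the
tree's smoothing bootstrap turns it into global pseudo-solutions for every κ — the orthant conjunct
of the rung target
(X_glue = OrthantBreakOfWake, using X_cone = OrthantInvariance). No idea card is realised
(cell-internal rung line).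
Lean: `KPBlockWake → OrthantInvariance → ForwardSourceSmoothing → KPBreakOfBlockWake →
NonDiagonalOrthantBreak → NonOrthantBreak →
Summit.NavierStokesRegularity.NavierStokesRegularity.Theses.TaoLadderRungTwoBreak.Target`

## Assembly
Pure logic, PROVED in glue.lean (`closes`, kernel-checked with Sketch7: rc 0, 0 sorries; native
check before the edit): fix R ≥ 1; KPBreakOfBlockWake fed with KPBlockWake, OrthantInvariance and
ForwardSourceSmoothing gives ε₁ and the KP conjunct; NonDiagonalOrthantBreak gives ε₃ and the
non-diagonal orthant pocket; NonOrthantBreak gives ε₂ and the non-orthant complement; take εR = min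
ε₁ (min ε₃ ε₂) and split `by_cases` on the orthant sign predicate of α and, inside, on the
diagonal-feed predicate. CONJUNCT SPLIT (declared): attacked = KP conjunct (orthant ∧ diagonal
feeds); residuals = NonOrthantBreak (non-orthant tables, unchanged since rev 1) and
NonDiagonalOrthantBreak (new, rev 4).

CLOSES_TARGET: closes rung TL-M2Break of NavierStokesRegularity: Summit.NavierStokesRegularity.NavierStokesRegularity.Theses.TaoLadderRungTwoBreak.Target (D-0061; not the summit Statement) — the deciding theorem of this route concludes that registered leaf instead of the Statement decl `NavierStokesRegularity` (class rung: servable and labelled, never counted as concluding the summit Statement).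

Rationale: WHY THIS LINE. The only table of Tao's class whose small-or-large-ε₀ fate is decided is the dyadic
member at ε₀ = 1 (BMR 2011, in the tree as
`not_noGlobalCascade_one_dyadicTable`), by a two-dimensional invariant region whose numerics are
pinned to the shell ratio 2 (barrier audit of
`DyadicCascadeRegularity`); removing "λ = 2" and "m = 1" is asked for in print (arXiv:1506.07480 p.
3; arXiv:2209.10203 §3.2). This line replaces the
region by a MONOTONE RUNNING MAXIMUM that is insensitive to the ratio — the tail-energy ratchet — on
the largest class where positivity survives (orthant
tables = KP networks, an explicit algebraic subclass of E₂(R) closed under in-shell chaining and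
branching), and imports the regularity half verbatim from
the tree (`exists_viscousGlobal_of_subcriticalEnvelope_of_inTableClass`,
`hasGlobal_of_viscousGlobal`, `noGlobalCascade_iff_kappa`). Imported areas:
positive dynamical systems (Kamke quasi-positivity, closed-cone invariance) and shell-model cascade
theory (BarbatoMorandinRomito2011, Cheskidov2008,
arXiv:1201.2693; the K41 fixed point / decaying self-similar solutions of the dyadic member:
arXiv:math/0610815, arXiv:0811.1689; the λ → 1 continuum
picture: arXiv:1409.4682, arXiv:chao-dyn/9905016). The constants η, κ₁, ε̄ are chosen BEFORE ν: the
crux is a statement about arbitrarily long inertial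
ranges (uniform in Re), and its Re = ∞ number has been computed (instrument of record F2,
kit/inviscid_front.py, jobs j297482/j297508/j297509, evidence
memo F2_inviscid_front.md on the crux item): the inviscid self-similar front of five orthant
networks — dyadic D, KP chains C2, C4, and two BRANCHED
networks that are not dyadic chains in disguise, B3 (0→{1,2}→3→0′) and B2f (two feeds 0→0′, 0→1′
plus an in-shell KP pair), all entries of modulus ≤ 1
— leaves a wake with exponent W_front(ε₀) > 1 in all 30 cells (ε₀ = ½ … 1/64), tending to W* = 5/3,
the Kolmogorov constant-flux exponent, as ε₀ → 0.

RANKED CRUXES. #2 KPBlockWake (crux, R1⁗, NEW rev 4) — ∀ R ≥ 1 ∃ η > 0 ∃ L ≥ 1 ∃ κ₁ > 0 ∃ ε̄ ∈ (0,1]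
∀ ε₀ ≤ ε̄ ∀ ν > 0 ∀ α ∈ E₂(R) orthant with DIAGONAL forward feed forms (∀ a b i, a ≠ b → α a b i
(0,0,1) = 0) ∃ S ⊇ S⁺(α) ∀ X₀ ∀ s ∀ regular ν-viscous solution X on [0,s] non-negative on shells ≥
1: ∀ n with nε₀ ≥ κ₁ ∀ t ≤ s ∃ u ≤ t, T⁺_(n+L)(t) ≤ (1+ε₀)^(−(1+η)L) T⁺_n(u), T⁺_n = Σ_(k≥n) Σ_(i∈S)
½X_(i,k)². [difficulty: XL] (why it might fail: a KP network whose stationary modulation is not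
shell-periodic with bounded period — coprime cycles through one mode, drifting fronts — or an
L-block exponent tending to 1 as ε₀ → 0 on the dumbbell family (1.257 at 1/8, 1.303 at 1/16; 1/64
pending kit j303108), killing every fixed (η, L) uniform in ε₀ ≤ ε̄; or ν-dependent capacitor
re-entry into a source.) [kit:j303295, kit:j303489, CENSUS-24639-v3, BarbatoMorandinRomito2011,
arXiv:1402.0290, Cheskidov2008, Tao2016AveragedNS]. BC7 CLEAN vs the rung Target (P1/P2/P2h/P5 ok);
BC2 KPBlockWake → Target heartbeat-exhaust, Target → KPBlockWake exhaust (folder repair6/bc). STATE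
OF RECORD (rev 9, 2026-08-28; KEY-NS #124/#133 (a)/#138 BINDING, DIRECTOR-NS #204 (6)): PARKED — no
structural prover hours, no skeleton of record, no kit. PRICE TAG (LEAD census v1/v2 + idea-crit-3
(B)): restricted to α = c·dyadicTable this statement (+ KPBreakOfBlockWake + ForwardSourceSmoothing)
is a ν-uniform super-critical block ratchet for the Katz–Pavlović chain at EVERY small ratio, hence
contains critical viscous dyadic regularity uniformly in the ratio (in print at λ = 2 only, BMR
2011) ⇒ every structural stub ≥ open-in-print: a price, not a strike. The cluster's ONE structural
plan is SubOnsagerCeiling's ForwardTailCeilingKP (stmt-27057, skeleton «kp-shell-barrier»); edges of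
record, all PROVED as typed: 27057 ⇒ 27130 (`forwardSourceTailEnvelopeKP_of_forwardTailCeilingKP`
p622470), KPBlockWake ⇒ 27130 (`forwardSourceTailEnvelopeKP_of_kpBlockWake` p624862, S := S⁺(α)).
KEY-NS #138: (1) the open model-lattice frontier «b < 1.7 via ≥ 3-window certified regions + the
general-KP energy/time-integral ingredient» is ONE certificate factory = LEAD SOC alone; (2) OW's
reusable kernel pipeline for the research rung — shape-free socket p626421
`not_noGlobalCascade_dyadicTable_of_weightBound` (∀ ε₀ > 0: ν-uniform weighted sup bound, w > 1/2 ⇒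
¬NoGlobalCascade), 2-mode region p627061/p627466, transport p628372/p629117, enclosure p629805,
certificates p629445 (b = 7/4), p630847 ([3/4,1]), p631429 ([13/20,1]) — CONSUMES soc-p2's regions
by name from now on (no second factory); OW hours go to OW-specific objects only (26999 census; twin
side-branch / S⁺-restricted variants only if keyed); (3) SE takes no structural hour on 27130 until
the W5 word; (4) kernel facts of record: aside 24644 DyadicBreakBelowOne PROVED on [7/10,1] for
c·dyadicTable, 0 < c ≤ 1 (soc-p2 p626568, from the ν-uniform θ = 101/200 shell barrier
`dyadicRange_shellBarrierAt` p625959, all b ∈ [1.7,2]) and on [13/20,1] for dyadicTable (ow-p1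
p631429); OPEN below 13/20; 2-window BMR/BM-type regions provably end near b ≈ 1.58–1.62 (both
memos: slope budget K·D ≳ 3). BINDER VET (refuter1 g12, #212 (2), 11:41Z, K-118): PASS-AS-TYPED — no
vacuity (zero table honest), no junk value (rpow bases > 0, tsum tails summable under the weight
bound), quantifier order = the price tag ((η, L, κ₁, ε̄) from R alone; L ≥ 2 operative). W5
(weak-leak pocket matrix; run of record kit j304565 + j304977, reruns j306164/j307577/j307578;
replication kp.c): provisionally CLEAR at this writing (12-block ≥ 1.257; Θ^S α_SB^leak ≥ 1.159;
T₁₀^leak head transient only); the critic's FINAL word («W5 CLEAR (run of record agrees)» unfreezes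
27057's structural hours per #133 (a)/#204 (6); DISAGREE keeps the freeze) is recorded on the items
as evidence, not in this header.
#3 NonOrthantBreak (crux, stmt-24640) — RESIDUAL CONJUNCT #1 (declared, unchanged): non-orthant
tables; not attacked by this line. [difficulty: XL]
#3 NonDiagonalOrthantBreak (crux, NEW rev 4) — RESIDUAL CONJUNCT #2 (declared): orthant tables with
a non-diagonal forward feed form (the twin-embedding pocket); not attacked by this line; recorded
plan = basis-free source space V⁺(α) = (⋂_i ker A_i)^⊥ (feed forms of orthant tables are copositive
symmetric Z-matrices, hence PSD, so zero forward flux ⇔ common kernel) + rotation covariance of the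
lattice. [difficulty: L–XL] (why it might fail: feed forms not simultaneously diagonalisable and
kernel-direction energy recycled into V⁺ at a ν-dependent rate; or small-ε₀ global existence simply
fails on such a table — it is a special case of the open rung.) [HOME INBOX idea-crit-3 2026-08-28
twin embedding; REFUTATION-EVIDENCE stmt-25507; CENSUS-24639-v3 §C.3]. BC7 CLEAN; BC2 both
directions fail by tactic (Target → it holds logically: special case).
#3 ForwardSourceSmoothing (crux, stmt-26374, SHARED with SubcriticalEnvelope and SubOnsagerCeiling)
— PROVED 2026-08-28T07:51Z (`forwardSourceSmoothing_proof`).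
#4 KPBreakOfBlockWake (crux = glue with content, NEW rev 4; PROVED 2026-08-28 ≈10:08Z,
`kpBreakOfBlockWake_proof`, p623971 — `forwardBreak_blockEnvelope`: S-block ratchet from the head
shell + T^S ≤ E₀ ⇒ ν/window/horizon-free subcritical envelope with constant
E₀(1+ε₀)^((1+η)(⌈κ₁/ε₀⌉+L))) — KPBlockWake → OrthantInvariance → ForwardSourceSmoothing → KP
conjunct; proof = the landed orthantBreakOfWake_proof with T⁺ for T and the induction on the
progressions n₀ + jL (head tails ≤ E₀, block ratchet on running maxima ⇒ ν-uniform envelope with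
constant e^((1+η)κ₁)2^((1+η)(L+1)) ⇒ smoothing at each κ). [difficulty: M] (why it might fail: low
formal risk — continuity/summability of T⁺_n, residues r < L via monotonicity of tails in n, partial
sums vs tsums, the cast (n + L : ℕ).) [tree:Theorems/OrthantWakeOrthantBreakOfWake.lean,
tree:Theorems/SubcriticalEnvelopeForwardSourceSmoothingFar.lean]. BC7 CLEAN.
#9 OrthantInvariance (support, stmt-24642, PROVED). ASIDES (settled, never reworded): OrthantHopWake
(stmt-24639, total-energy per-hop ratchet: T₁₀), ForwardHopWake (stmt-26438, forward-source PER-HOP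
ratchet: refuted-misstated in numerics by asymmetric 2-cycles, kit j303295 Z02/Z08/Z17 and j303489
T2(c ≤ 0.8), and on non-diagonal tables by the twin embedding), ForwardBreakOfWake (stmt-26443, glue
of 26438), OrthantBreakOfWake (stmt-24641, proved, rev-1 glue), DyadicBreakBelowOne (stmt-24644).

TWO-LAYER PLAN. OrthantHopWake ⇐ TailFluxBudget (energy balance of the tail: T_(n+1)(t) ≤ ∫₀ᵗ Π_n,
Π_n = (1+ε₀)^(5n/2) Σ α_(i₁i₂i)(0,0,1) X_(i₁,n)
X_(i₂,n) X_(i,n+1) ≥ 0 the bond flux, dissipation dropped) → FluxCappedByResidue (THE LEVER: ∫₀ᵗ Π_n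
≤ (1+ε₀)^(−(1+η)) max_(u≤t) T_n(u) beyond the
transient depth: while bond n carries flux the receiver drains onward or burns, the emitter stalls
with a residue — BMR's "energy cannot concentrate" in
ratchet form); registered as the BC3 skeleton line2/bc/birth.lean (stubs stub_tailFluxBudget,
stub_fluxCappedByResidue, composition OrthantHopWake_of
kernel-checked). Foreseen layer-2 of FluxCappedByResidue, guided by F2 (two regimes, glued by max):
(a) AfterglowCap — on the cone, once bond n−1 is
spent, the residues (X_n, X_(n+1), …) are dominated by the K41 decaying comparison family
c(t)λ^(−5k/6) (the exact steady state; BFM's self-similar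
decaying solutions), which caps every later gain of T_(n+1) at λ^(−5/3)·T_n — a comparison/Lyapunov
statement about the K41 profile, the place where a
monotone quantity lives (relative entropy Σ_k φ(E_k / k41_k) is the candidate); (b) FrontWake —
during the passage, the emitter's residue is at least
(1+η′)ε₀ of the arriving tail energy (W_front > 1): the genuinely open piece; continuum guide =
entropy shock trailing the constant-flux rarefaction,
lattice tool wanted = a discrete one-sided (Oleinik/Brenier–Osher) bound for a conservative
NON-monotone two-point flux with positive net numerical
viscosity. OrthantBreakOfWake ⇐ RatchetToEnvelope (induction on n with the running maximum) → tree
smoothing.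

KILL CRITERIA. F2⁗: a fixed-spread KP network family (orthant, diagonal feeds) on which the 12-block
(equivalently every-L-block) exponent of the forward-source tail stays ≤ 1 on a band of shells that
grows without bound as ν ↓ at some ε₀ ≤ ε̄ for every ε̄ refutes KPBlockWake and closes the KP half
of the line (close --reason refuted:KPBlockWake); first tests on record: kit j303489/j303958
(period-3, period-4 and mixed 2+3 cycles, in-shell variant) and kit j303108 (ε₀ = 1/64: dumbbell,
T₁₀, α_SB, capacitor at N = 1460). FIRED AND RECORDED, not re-litigated: F2′ (total-energy ratchet
24639, T₁₀), F2″ (per-hop forward-source ratchet 26438: asymmetric 2-cycles W⁺_low = 0.17–0.98; twin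
embedding on non-diagonal tables). A refutation of ForwardSourceSmoothing is moot (proved). If
SubOnsagerCeiling's ceiling closes first on the KP class the route is superseded. A kernel proof
that some non-diagonal orthant table in E₂(R) blows up at arbitrarily small ε₀ refutes
NonDiagonalOrthantBreak and with it the rung target itself.

NOT DECOMPOSED YET. The stalling-residue lemma FrontWake inside FluxCappedByResidue (layer-2, the
open content of W_front > 1 at fixed ε₀); the
AfterglowCap comparison with the K41 family (plausibly M–L once cone invariance is a Literature
lemma); the convergence of the lattice front to the
continuum entropy solution (the honest content of W* = 5/3; only some η > 0 is claimed, so it is NOT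
load-bearing); and the algebraic characterisation
"orthant ⇔ all interactions are KP pairs" (kept informal; the route uses only the semantic sign
predicate). NonOrthantBreak is residual and
deliberately undecomposed here. REV 4 ADDITION: the basis-free source space V⁺(α) (projection form
of T⁺) and the rotation-covariance lemma of the lattice (orthogonal mode mixing preserves solutions,
energies, ViscousGlobal and E₂ up to a constant in R) that would dissolve NonDiagonalOrthantBreak
into the KP case — deliberately not filed this revision (needs a projected ForwardSourceSmoothing).
INSTRUMENT ROW (KEY-NS #124; the research RUNG below KPBlockWake — tenure text of record, NOT an
item, never staffed as a crux): «λ-UNIFORM BMR INVARIANT REGION for the one-mode Katz–Pavlović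
chain» (α = c·dyadicTable at shell ratio b = 1+ε₀, honest ν-viscous lattice) — BMR 2011's one-ratio
theorem (λ = 2, aside DyadicBreakBelowOne) made λ-uniform, strictly below the crux (no ratchet, one
mode). CORRECTION OF RECORD (ow-p1 g5 memo RUNG-BMR-RATIO = evidence #9 on 26999; soc-p2 census v3;
idea-crit-3 11:33Z): 2-window BMR/BM-type exact certificates exist only for b ∈ [≈1.62, 2]
(optimised margins +0.42 @ 2, +0.09 @ 1.7, +0.02 @ 1.62, −0.015 @ 1.6), so the row splits into (i)
2-window certificates on [b₀, 2] — DONE IN THE KERNEL with 0 kit on [1.65, 2] (p625959/p626568;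
p629445/p630847/p631429), and (ii) the genuinely open design «k-window (k → ∞ as b ↓ 1) or
front-tracking certificates for small ε₀», nothing in print — owned by the ONE certificate factory
(LEAD SOC, #138 (1)) and consumed here through the shape-free socket p626421; no kit anywhere until
a director token.

CHEAPEST FALSIFIER. ONE batched kit job with kp_lattice.py (validated to 3 digits against lattice.c;
block columns L ∈ {1,2,3,4,6,12} via num/analyze_blocks.py, lid-safe band): KP networks with coprime
cycle structure — {F 0→1 (1), F 1→0 (0.3), F 0→2 (0.5), F 2→3 (0.4), F 3→0 (0.2)} (2-cycle + 3-cycle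
through mode 0), the 3-cycle (1, 0.5, 0.2), the 4-cycle (1, 0.5, 0.25, 0.6) — at ε₀ ∈ {1/8, 1/16,
1/32, 1/64} × ν ∈ {1e-8, 1e-10}, N doubled once: kill = min over the band beyond κ₁ of the 12-block
exponent < 1, band growing as ν ↓. ROWS ON RECORD: j296951 (F2 fronts), WAKE-SCAN, j299186,
CENSUS-24639-v3 §C, kit j302483/j302646 (38 rows: T⁺ ceilings clean, total tail killed by pockets),
kit j303295 (64 random KP networks: block exponents ≥ 1.233 on 49/49 cascading; per-hop killed on
6/49), kit j303489 (T2(c): per-hop 1.555/1.233 (c=1), 1.274/0.977 (0.8), 0.930/0.739 (0.6),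
0.669/0.629 (0.5) at ε₀ = 1/4 / 1/8 vs 2-block 1.555/1.233, 1.573/1.270, 1.647/1.423, 1.657/1.576).

NUMBERS. K41-afterglow law check (sup ratio vs max(front, λ^(−5/3))): ε₀ = 1: 0.30 vs 0.315; ½:
0.507 vs max(0.400, 0.509); ¼: 0.705 vs max(0.706,
0.689); ⅛: 0.864 vs max(0.864, 0.822). Blow-up times of the inviscid front (datum e₀, converged in
N): D t* = 1.065, 2.150, 4.249, 8.754, 19.745,
51.257 (ε₀ = ½ … 1/64); C4 7.071, 11.81, 23.38, 55.98, 144.24, 387.71; B3 4.825, 8.114, 15.65,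
35.95, 91.72, 245.0. Front-zone width (unconverged
shells behind the arrival shell) ≈ 2.5/ε₀. Earlier rows (j296421/j296476 bulk ratios; j296951
windows; first-hop transient r₀…r₃ = 0.96, 0.94, 0.92,
0.91 at (⅛, 5·10⁻⁴)) stand as filed at rev 0.

DEFINITION REQUESTS. (1) REUSABLE LITERATURE LEMMA wanted (critic P4; serves OrthantInvariance here
and every positivity argument on the ladder):
closed-convex-cone (more generally closed-convex-set) forward invariance for x′ = F(x) with F
locally Lipschitz on a Banach space E under the
subtangency / quasi-positivity condition (x ∈ ∂K, φ ∈ K*, φ(x) = 0 ⇒ φ(F x) ≥ 0) — Nagumo 1942 /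
Brezis 1970 / Martin 1973, and Volkmann 1972
(quasimonotone infinite systems in sequence spaces); topic Literature/Analysis/ODE (ConeInvariance);
the lattice instance is then ten lines in the
weighted sup-norm space of LocalCascadeSolutions. (2) Foreseen: `IsKPNetwork α` := orthant sign
predicate ∧ diagonal forward feed forms (rev 4 uses the two predicates inline); topic
Summits/NavierStokesRegularity/NavierStokesRegularity/Theorems. (3) Foreseen for
the layer-2 FrontWake line only: Kruzhkov entropy solution of a scalar conservation law with
κ-dependent convex flux on a half-line and the discrete
one-sided Lipschitz (Brenier–Osher) framework; topic Literature/Analysis/PDE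
(ScalarConservationLaw).

Novelty: Searches (2026-08-28): lit search --hybrid "multi-component vector dyadic shell model positive
solutions global regularity tree model" (6: arXiv:1506.07480 pp 19–20, arXiv:2501.07377,
arXiv:2407.06776; rest off-topic); lit search "dyadic model regularity positive Barbato" (6 local:
arXiv:1403.2852 p11, arXiv:2209.10203 pp 10–11, 21, arXiv:1201.2693 p13); lit galaxy search "dyadic
model|tree model of turbulence|Katz-Pavlovic" --star pdf (6 rows, all off-topic: no hits) and
"dyadic model|shell model|Katz-Pavlovic" --star all (24 junk rows: no hits); lean search
InTableClass / quadTerm / ViscousGlobal (tree vocabulary only; no orthant/positivity predicate for m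
≥ 2 in the tree); ledger negatives NavierStokesRegularity (5, none on cascades).
Nearest prior art found: BarbatoMorandinRomito2011 = arXiv:1007.3401 (positive scalar dyadic at
ratio 2: invariant region, no ratchet), arXiv:1506.07480 p. 3 ("one would like to remove the
non-negativity of the data and the fixation λ = 2; we are unable to…"), arXiv:2209.10203 §3
(tree/multi-branch dyadic models: positivity used, NS-scaling regularity open off ratio 2), and in
the tree route-NavierStokesRegularity-SubcriticalEnvelope (the envelope ⇒ regularity half for ALL
tables, no positivity, no ratchet) and route-NavierStokesRegularity-WakeRatchet (a wake floor for
eternal RENORMALISED solutions at λ = 1, all tables).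
Delta: the positive cone of Tao's four-mode class (orthant tables = KP networks) as the arena, and
on it a ratio-insensiti  [refs: 1506.07480, 2501.07377, 2407.06776, 1403.2852, 2209.10203, 1201.2693, 1007.3401, BarbatoMorandinRomito2011]

Barriers (technique_class: cone-invariance, tail-ratchet, smoothing-bootstrap, split): - technique_class: cone-invariance, tail-ratchet, smoothing-bootstrap, split
- Literature.Barriers.NavierStokesRegularity.DyadicCascadeRegularity: consistent, and the point of
departure — the barrier records that BMR's region is certified for shell ratio 2 only [corpus:
Literature/Barriers/NavierStokesRegularity/DyadicCascadeRegularity.lean audit; arXiv:1506.07480 p3];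
the ratchet is the ratio-free replacement and the dyadic member at ε₀ = 1 is the BC5 analogue
(`not_noGlobalCascade_one_dyadicTable`).
- Literature.Barriers.NavierStokesRegularity.TaoAveragedBlowup: does not bite — Tao's blow-up tables
use amplifier/rotor gates (x_j x_i → x_i with −x_i² → x_j), which violate the Kamke condition, so
they are non-orthant and fall in the RESIDUAL conjunct; and the rung fixes the spread R while Tao
needs R(ε₀) → ∞ [corpus: DyadicCascadeRegularity.lean docstring quoting arXiv:1402.0290 §1.2 p.
9–10].
- Literature.Barriers.NavierStokesRegularity.EnergySupercriticality: outside its class — a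
cone-invariance/monotone-maximum argument for a model lattice, not an energy-class a-priori estimate
for NS; positivity is extra structure NS lacks (honestly: this is why the line says nothing about
NS).
- Literature.Barriers.NavierStokesRegularity.FrozenShellShapeNoDephasing: does not bite — no
intra-shell equipartition or dephasing law is asserted; the ratchet is an inter-shell energy budget.
- Negatives index: 5 refuted NS statements at filing (OddMorawetz 1376, SymmetryModuliCount 4055,
Perpet

History (route lifecycle, newest last):
- 2026-09-03T00:43:27Z · DORMANT — reconciler: no traction for 5 d (last activity statement-checked at 2026-08-29T00:08:37Z); parked, not closed — `ledger route dormant route-NavierStokesRegulari (operator:999:3500620)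

sub-problem: NavierStokesRegularity · status: dormant · opened planner-ns-idea-1-g3-0 2026-08-28T02:04:49Z · rev 9 · ledger route-NavierStokesRegularity-OrthantWake
GENERATED by the gate from the ledger (D-0016/17). Provers cite these decls: `theorem foo : Summit.NavierStokesRegularity.NavierStokesRegularity.Theses.OrthantWake.<Decl> := …` in Summits/NavierStokesRegularity/NavierStokesRegularity/Theorems/<Name>.lean.
-/

namespace Summit.NavierStokesRegularity.NavierStokesRegularity.Theses.OrthantWake

open scoped BigOperators Topology Manifold Classical MeasureTheory ProbabilityTheory Matrix InnerProductSpace ComplexConjugate ContinuousMap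
open Filter Set Function TopologicalSpace MeasureTheory

attribute [summit_statement] _root_.NavierStokesRegularity
attribute [summit_statement] _root_.Summit.NavierStokesRegularity.NavierStokesRegularity.Theses.TaoLadderRungTwoBreak.Target

open Literature.NS

/-- item stmt-NavierStokesRegularity-26999 · crux · rank 2 · open · by planner
why it might fail: A KP network whose modulation is not shell-periodic with bounded period (coprime cycles, drifting fronts), or a dumbbell 12-block exponent (1.257 at 1/8, 1.30 at 1/16) tending to 1 as ε₀ → 0, kills every fixed (η, L) uniform in ε₀ ≤ ε̄; so does ν-dependent capacitor re-entry into a source.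
sources: kit:j303295, kit:j303489, kit:j303958, CENSUS-24639-v3, BarbatoMorandinRomito2011, arXiv:1402.0290
[crux] KP BLOCK WAKE (R1⁗ — repair of ForwardHopWake stmt-26438, which stays in the file as the
settled numerical negative: its PER-HOP ratchet T⁺_{n+1}(t) ≤ b^{−(1+η)} sup_{u≤t} T⁺_n(u) is false
on ASYMMETRIC 2-CYCLE orthant tables — e.g. {F 0→2 (0.846), F 2→0 (0.194)} (kit j303295 table Z02;
also Z08 = {F 0→3 (0.247), F 3→0 (0.631)}, Z17 = {F 0→1 (0.132), F 1→3 (0.807), P 3→0 (0.177)}) — at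
ε₀ = 1/4 AND 1/8, ν = 1e-8: the pump graph is bipartite in shell parity and the constant-flux
(Kolmogorov) profile c_n A_n² A_{n+1} = const puts the standing energy on the shells of the WEAKLY
pumping mode (A_weak/A_strong = c_strong/c_weak), so across a strongly-pumping shell the source tail
drops only by the factor 1 + (c_w/c_s)² b^{5/3}(1 − b^{−10/3}) — measured per-hop exponents
alternate 0.170/3.164 (Z02), 0.446/2.867 (Z08), 0.368/2.946 (Z17), ε₀-independent, mean 5/3;
prediction: the per-hop form fails for every 2-cycle with c_w/c_s ≲ 0.55 at all small ε₀, hence for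
every R ≥ 2; confirmation matrix kit j303489). Every 2-BLOCK average on the same 48 cascading random
orthant networks is ≥ 1.233 (ε₀ = 1/8) / ≥ 1.329 (ε₀ = 1/4), and the tail CEILINGS are untouched (Θ⁺
≥ 1.02 beyond κ = 2 on -/
@[route_item "route-NavierStokesRegularity-OrthantWake"]
def KPBlockWake : Prop :=
  ∀ R : ℝ, 1 ≤ R → ∃ η : ℝ, 0 < η ∧ ∃ L : ℕ, 1 ≤ L ∧ ∃ κ₁ : ℝ, 0 < κ₁ ∧ ∃ εbar : ℝ, 0 < εbar ∧ εbar ≤ 1 ∧ ∀ ε₀ : ℝ, 0 < ε₀ → ε₀ ≤ εbar → ∀ ν : ℝ, 0 < ν → ∀ α : Fin 4 → Fin 4 → Fin 4 → ℤ × ℤ × ℤ → ℝ, Literature.Analysis.FluidPDE.TaoCascade.InTableClass R α → (∀ (Y : Fin 4 → ℤ → ℝ → ℝ) (τ : ℝ), (∀ (j : Fin 4) (k : ℤ), 1 ≤ k → 0 ≤ Y j k τ) → ∀ δ : ℝ, 0 < δ → ∀ (i : Fin 4) (n : ℤ), 1 ≤ n → Y i n τ = 0 → 0 ≤ Literature.Analysis.FluidPDE.TaoCascade.quadTerm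 δ α Y i n τ) → (∀ a b i : Fin 4, a ≠ b → α a b i (0, 0, 1) = 0) → ∃ S : Finset (Fin 4), (∀ i, i ∉ S → ∀ j l : Fin 4, α i j l (0, 0, 1) = 0) ∧ ∀ (X₀ : Fin 4 → ℝ) (s : ℝ), 0 < s → ∀ X : Fin 4 → ℤ → ℝ → ℝ, (∀ (i : Fin 4) (k : ℤ), X i k 0 = if k = 0 then X₀ i else 0) → (∀ (i : Fin 4) (k : ℤ), k < 0 → ∀ t : ℝ, X i k t = 0) → (∃ M : ℝ, ∀ (t : ℝ) (i : Fin 4) (k : ℤ), (1 + (1 + ε₀) ^ ((10 : ℝ) * k)) * |X i k t| ≤ M) → (∀ (i : Fin 4) (k : ℤ), Continuous (X i k)) → (∀ (i : Fin 4) (k : ℤ), ∀ t ∈ Set.Icc (0 : ℝ) s, HasDerivWithinAt (X i k) (Literature.Analysis.FluidPDE.TaoCascade.quadTerm ε₀ α X i k t - ν * (1 + ε₀) ^ ((2 : ℝ) * k) * X i k t) (Set.Icc (0 : ℝ) s) t) → (∀ t ∈ Set.Icc (0 : ℝ) s, ∀ (i : Fin 4) (k : ℤ), 1 ≤ k → 0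 ≤ X i k t) → ∀ n : ℕ, κ₁ ≤ ε₀ * n → ∀ t ∈ Set.Icc (0 : ℝ) s, ∃ u ∈ Set.Icc (0 : ℝ) t, (∑' j : ℕ, ∑ i ∈ S, (1 / 2 : ℝ) * X i ((n + L : ℕ) + (j : ℤ)) t ^ 2) ≤ (1 + ε₀) ^ (-((1 + η) * (L : ℝ))) * (∑' j : ℕ, ∑ i ∈ S, (1 / 2 : ℝ) * X i ((n : ℕ) + (j : ℤ)) u ^ 2)

/-- item stmt-NavierStokesRegularity-24640 · crux · rank 3 · open · by planner
why it might fail: it is the rung target on the generic (gated, sign-mixing) tables — Tao-type circuits with spread R(ε₀) → ∞ blow up, and a fixed-spread gated table efficient as ε₀ → 0 would refute it; no mechanism of this line applies off the cone.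
sources: arXiv:1402.0290, Tao2016AveragedNS, arXiv:2501.07377
[crux] RESIDUAL CONJUNCT (declared): for every R ≥ 1 there is εR > 0 such that for ε₀ ≤ εR every
NON-orthant table α ∈ E₂(R) and every one-shell datum admit global pseudo-solutions
(¬NoGlobalCascade ε₀ α X₀). Not attacked by this line (it is the complement of the orthant conjunct;
the lines WakeRatchet / SubcriticalEnvelope / LatticeTransitLiouville / TransitMassLedger bear on
it). [difficulty: XL] -/
@[route_item "route-NavierStokesRegularity-OrthantWake"]
def NonOrthantBreak : Prop :=
  ∀ R : ℝ, 1 ≤ R → ∃ εR : ℝ, 0 < εR ∧ ∀ ε₀ : ℝ, 0 < ε₀ → ε₀ ≤ εR → ∀ (α : Fin 4 → Fin 4 → Fin 4 → ℤ × ℤ × ℤ → ℝ) (X₀ : Fin 4 → ℝ), Literature.Analysis.FluidPDE.TaoCascade.InTableClass R α → ¬ (∀ (Y : Fin 4 → ℤ → ℝ → ℝ) (τ : ℝ), (∀ (j : Fin 4) (k : ℤ), 1 ≤ k → 0 ≤ Y j k τ) → ∀ δ : ℝ, 0 < δ → ∀ (i : Fin 4) (n : ℤ), 1 ≤ n → Y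 i n τ = 0 → 0 ≤ Literature.Analysis.FluidPDE.TaoCascade.quadTerm δ α Y i n τ) → ¬ Literature.Analysis.FluidPDE.TaoCascade.NoGlobalCascade ε₀ α X₀

/-- item stmt-NavierStokesRegularity-26374 · crux · rank 3 · closed · proved by Summit.NavierStokesRegularity.NavierStokesRegularity.Theorems.forwardSourceSmoothing_proof (prover) · by planner
why it might fail: Slaving of non-source modes needs every power term into them to carry a source amplitude or a source pair below (rotor identity, (4.2)–(4.3), Tao's shift set) plus ⌈1/η⌉ catalyst passes lifting their decay exponent above 1/2; a missed coupling type or a non-summable energy identity breaks it.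
sources: Tao2016AveragedNS, BarbatoMorandinRomito2011, Literature:exists_viscousGlobal_of_subcriticalEnvelope_of_inTableClass, Literature:viscous_bootstrap_step
[crux] FORWARD-SOURCE ENVELOPE SMOOTHING (fixed ν, constants free; rank 3 — a real extension of the
landed engine, not a citation). If S contains every forward source of α ∈ E₂(R) (i ∉ S ⇒ α i j l
(0,0,1) = 0) and on every window [0,T] the S-mode partial tail energies of all regular ν-viscous
solutions on sub-windows [0,s] obey a subcritical envelope C(T)(1+ε₀)^{−(1+η)n}, then a GLOBAL
regular solution of the ν-viscous lattice exists (`ViscousGlobal ε₀ ν α X₀ X`). The landed engine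
`exists_viscousGlobal_of_subcriticalEnvelope` (p593260; bootstrap `viscous_bootstrap_step` γ ↦ 2γ −
1/2 from any γ > 1/2, continuation `exists_viscousGlobal_of_apriori_bound`) needs the envelope on
ALL modes; the new step is the SLAVING of the non-source modes D = Sᶜ: per shell k ≥ 1 they start
empty, receive (0,0,1)-injection only from PAIRS of sources at shell k−1 (α a b d (0,0,1) ≠ 0 forces
a, b ∈ S by (4.2)), exchange energy with same-shell sources only through terms carrying a source
amplitude (in-shell triads) or through rotors catalysed by a shell-(k+1) amplitude whose partner is
a source (two-shell triads with vanishing (0,0,1) coefficient are rotors inside the lower shell by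
(4.2)–(4.3)), and ar -/
@[route_item "route-NavierStokesRegularity-OrthantWake"]
def ForwardSourceSmoothing : Prop :=
  ∀ (ε₀ η R : ℝ), 0 < ε₀ → 0 < η → ∀ α : Fin 4 → Fin 4 → Fin 4 → ℤ × ℤ × ℤ → ℝ, Literature.Analysis.FluidPDE.TaoCascade.InTableClass R α → ∀ S : Finset (Fin 4), (∀ i, i ∉ S → ∀ j l : Fin 4, α i j l (0, 0, 1) = 0) → ∀ (X₀ : Fin 4 → ℝ) (ν : ℝ), 0 < ν → (∀ T : ℝ, 0 < T → ∃ C : ℝ, ∀ s ∈ Set.Ioc (0 : ℝ) T, ∀ X : Fin 4 → ℤ → ℝ → ℝ, (∀ i k, X i k 0 = if k = 0 then X₀ i else 0) → (∀ i k, k < 0 → ∀ t, X i k t = 0) → (∃ M : ℝ, ∀ (t : ℝ) (i : Fin 4) (k : ℤ), (1 + (1 + ε₀) ^ ((10 : ℝ) * k)) * |X i k t| ≤ M) → (∀ i k, Continuous (X i k)) → (∀ i k, ∀ t ∈ Set.Icc (0 : ℝ) s, HasDerivWithinAt (X i k) (Literature.Analysis.FluidPDE.TaoCascade.quadTerm ε₀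 α X i k t - ν * (1 + ε₀) ^ ((2 : ℝ) * k) * X i k t) (Set.Icc 0 s) t) → ∀ n N : ℕ, n ≤ N → ∀ t ∈ Set.Icc (0 : ℝ) s, ∑ k ∈ Finset.Icc n N, ∑ i ∈ S, (1 / 2) * X i (k : ℤ) t ^ 2 ≤ C * (1 + ε₀) ^ (-((1 + η) * (n : ℝ)))) → ∃ X : Fin 4 → ℤ → ℝ → ℝ, Literature.Analysis.FluidPDE.TaoCascade.ViscousGlobal ε₀ ν α X₀ X

-- `ForwardSourceSmoothing` holds: proved by `Summit.NavierStokesRegularity.NavierStokesRegularity.Theorems.forwardSourceSmoothing_proof` (its module imports this route file, so no `_holds` link can be stated here).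

/-- item stmt-NavierStokesRegularity-27000 · crux · rank 3 · open · by planner
why it might fail: Thin but real: an orthant table whose feed forms are not simultaneously diagonalisable by one mode rotation, with kernel-direction energy recycled into sources at a ν-dependent rate, escapes the rotation reduction and any V⁺-functional; small-ε₀ global existence could also just fail there.
sources: HOME-INBOX:idea-crit-3:2026-08-28:twin-embedding, REFUTATION-EVIDENCE:stmt-25507, CENSUS-24639-v3, Tao2016AveragedNS, kit:j302483
[crux] DECLARED RESIDUAL #2 (rank 3; not attacked by this line, exempt like NonOrthantBreak
stmt-24640): the NON-DIAGONAL ORTHANT POCKET — ∀ R ≥ 1 ∃ εR > 0 ∀ ε₀ ≤ εR ∀ α ∈ E₂(R) orthant whose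
forward feed forms are NOT all diagonal (some α a b i (0,0,1) ≠ 0 with a ≠ b) ∀ X₀, ¬NoGlobalCascade
ε₀ α X₀. This is exactly the pocket exhibited by the twin-embedding witness (idea-crit-3 / ns-ow-p1
g4, 2026-08-28): a dead-end pocket table (α_SB, T₁₀) rotated in a mode plane so that the parked
direction is the null direction of a rank-one feed form (4x_2 − 3x_3)²/16; on it every syntactic
forward-source functional equals the total tail energy and inherits the total-tail refutations (Θ →
5/9, W = 0.20–0.47). Why it is a thin pocket and what would attack it: for ORTHANT tables each
forward feed form A_i (matrix a,b ↦ α a b i (0,0,1)) is a symmetric Z-matrix that is copositive,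
hence positive semidefinite, so a shell configuration carries zero forward flux iff it lies in the
common kernel N(α) = ⋂_i ker A_i; the basis-free source space V⁺(α) = N(α)^⊥ (projection P) in place
of the coordinate set S⁺ defeats every rotated-pocket disguise (for the twin table V⁺ = span{e_0,
e_1, 4e_2 − 3e_3} and T^ -/
@[route_item "route-NavierStokesRegularity-OrthantWake"]
def NonDiagonalOrthantBreak : Prop :=
  ∀ R : ℝ, 1 ≤ R → ∃ εR : ℝ, 0 < εR ∧ ∀ ε₀ : ℝ, 0 < ε₀ → ε₀ ≤ εR → ∀ (α : Fin 4 → Fin 4 → Fin 4 → ℤ × ℤ × ℤ → ℝ) (X₀ : Fin 4 → ℝ), Literature.Analysis.FluidPDE.TaoCascade.InTableClass R α → (∀ (Y : Fin 4 → ℤ → ℝ → ℝ) (τ : ℝ), (∀ (j : Fin 4) (k : ℤ), 1 ≤ k → 0 ≤ Y j k τ) → ∀ δ : ℝ, 0 < δ → ∀ (i : Fin 4) (n : ℤ), 1 ≤ n → Y i n τ = 0 → 0 ≤ Literature.Analysis.FluidPDE.TaoCascade.quadTerm δ α Y i n τ) → ¬ (∀ a b i : Fin 4, a ≠ b → α a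 b i (0, 0, 1) = 0) → ¬ Literature.Analysis.FluidPDE.TaoCascade.NoGlobalCascade ε₀ α X₀

/-- item stmt-NavierStokesRegularity-24639 · aside · rank 2 · open · by planner
why it might fail: the KP lattice is dispersive, not a monotone scheme, so its front undershoots the entropy wake 5/3: measured W(ε₀) = 1.67, 1.56, 1.24, 1.29 (dyadic, ε₀ = ½…1/16) and 1.59, 1.29, 1.33 (2-chain; j296951) — non-monotone; a further drift to W ≤ 1 as ε₀ → 0 kills it.
sources: BarbatoMorandinRomito2011, arXiv:1007.3401, arXiv:1402.0290, arXiv:1506.07480, arXiv:2209.10203, Cheskidov2008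
[crux] for every R ≥ 1 there are η > 0, a transient depth κ₁ > 0 and ε̄ ∈ (0,1] such that for all ε₀
∈ (0, ε̄], ν > 0, every orthant table α ∈ E₂(R), every one-shell datum X₀ and every regular solution
X of the ν-viscous lattice on a window [0,s] that is non-negative on shells ≥ 1: for all shells n
with n·ε₀ ≥ κ₁ and all t ∈ [0,s] there is u ∈ [0,t] with T_(n+1)(t) ≤ (1+ε₀)^(−(1+η))·T_n(u) (tail
energies T_n = Σ_(k≥n) Σ_i ½X_(i,k)²) — the per-shell ratchet factor is super-critical (measured 1 +
η ≈ 1.3–1.7; continuum entropy guide 5/3). [difficulty: XL] -/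
@[route_item "route-NavierStokesRegularity-OrthantWake"]
def OrthantHopWake : Prop :=
  ∀ R : ℝ, 1 ≤ R → ∃ η : ℝ, 0 < η ∧ ∃ κ₁ : ℝ, 0 < κ₁ ∧ ∃ εbar : ℝ, 0 < εbar ∧ εbar ≤ 1 ∧ ∀ ε₀ : ℝ, 0 < ε₀ → ε₀ ≤ εbar → ∀ ν : ℝ, 0 < ν → ∀ α : Fin 4 → Fin 4 → Fin 4 → ℤ × ℤ × ℤ → ℝ, Literature.Analysis.FluidPDE.TaoCascade.InTableClass R α → (∀ (Y : Fin 4 → ℤ → ℝ → ℝ) (τ : ℝ), (∀ (j : Fin 4) (k : ℤ), 1 ≤ k → 0 ≤ Y j k τ) → ∀ δ : ℝ, 0 < δ → ∀ (i : Fin 4) (n : ℤ), 1 ≤ n → Y i n τ = 0 → 0 ≤ Literature.Analysis.FluidPDE.TaoCascade.quadTerm δ α Y i n τ) → ∀ (X₀ : Fin 4 → ℝ) (s : ℝ), 0 < s → ∀ X : Fin 4 → ℤ → ℝ → ℝ, (∀ (i : Fin 4) (k : ℤ), X i k 0 = if k = 0 then X₀ i else 0) → (∀ (i : Fin 4) (k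 : ℤ), k < 0 → ∀ t : ℝ, X i k t = 0) → (∃ M : ℝ, ∀ (t : ℝ) (i : Fin 4) (k : ℤ), (1 + (1 + ε₀) ^ ((10 : ℝ) * k)) * |X i k t| ≤ M) → (∀ (i : Fin 4) (k : ℤ), Continuous (X i k)) → (∀ (i : Fin 4) (k : ℤ), ∀ t ∈ Set.Icc (0 : ℝ) s, HasDerivWithinAt (X i k) (Literature.Analysis.FluidPDE.TaoCascade.quadTerm ε₀ α X i k t - ν * (1 + ε₀) ^ ((2 : ℝ) * k) * X i k t) (Set.Icc (0 : ℝ) s) t) → (∀ t ∈ Set.Icc (0 : ℝ) s, ∀ (i : Fin 4) (k : ℤ), 1 ≤ k → 0 ≤ X i k t) → ∀ n : ℕ, κ₁ ≤ ε₀ * n → ∀ t ∈ Set.Icc (0 : ℝ) s, ∃ u ∈ Set.Icc (0 : ℝ) t, (∑' j : ℕ, ∑ i : Fin 4, (1 / 2 : ℝ) * X i ((n + 1 : ℕ) + (j : ℤ)) t ^ 2) ≤ (1 + ε₀) ^ (-(1 + η)) * (∑' j : ℕ, ∑ i : Fin 4, (1 / 2 : ℝ) * X i ((n : ℕ) + (j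 : ℤ)) u ^ 2)

/-- item stmt-NavierStokesRegularity-26438 · aside · rank 2 · open · by planner
why it might fail: A source mode with ν-uniformly supercritical standing energy behind the front would break it: capacitor pocket with weak exit c = 1/R at small ε₀ (census C.1 tested c ≥ 0.1, ε₀ = 1/4 only), an in-shell KP chain recycling parked energy into a source, or W(ε₀) (1.67, 1.56, 1.24, 1.29) drifting ≤ 1.
sources: CENSUS-24639-v3, BarbatoMorandinRomito2011, arXiv:1402.0290, arXiv:1007.3401, Cheskidov2008, Tao2016AveragedNS
[crux] FORWARD-SOURCE HOP WAKE (R1″ — repair of OrthantHopWake stmt-24639, which stays in the file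
as the settled numerical negative: CENSUS-24639-v3, ns-ow-p1 g2, dead-end side-pocket orthant table
T₁₀ ∈ E₂(10), per-hop exponent of the TOTAL tail energy W = 0.20–0.47 < 1 on the whole inertial
window for ε₀ = 1/2 … 1/64, band lengthening as ν ↓; witness family covers every R ≥ 4). The ratchet
is restated for the FORWARD-SOURCE tail energies T⁺_n = Σ_{k≥n} Σ_{i∈S} ½X_{i,k}², S ⊇ S⁺(α) = {i :
∃ j l, α i j l (0,0,1) ≠ 0} (the modes that can move energy up a shell: only μ = (0,0,1) terms of
quadTerm drive a shell from below, and a two-shell triad with vanishing (0,0,1) coefficient is a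
rotor inside the lower shell by (4.2)–(4.3)); diode-parked dead-end energy (the T₁₀ mechanism)
leaves through the OBSERVABLE, not through a class restriction, so ALL orthant tables of E₂(R) stay
quantified and no pocket residual is needed. Constants (η, κ₁, ε̄) are still chosen BEFORE ν, α, X₀
(the content the critic asked to keep, 06:38:44Z point (4): R1 = pointwise ratchet risks being true
for the wrong reason via the dissipative cap p609496). STATEMENT: ∀ R ≥ 1 ∃ η > 0 ∃ κ₁ > 0 ∃ ε̄ ∈
(0,1] ∀ ε₀ ≤ ε̄ -/
@[route_item "route-NavierStokesRegularity-OrthantWake"]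
def ForwardHopWake : Prop :=
  ∀ R : ℝ, 1 ≤ R → ∃ η : ℝ, 0 < η ∧ ∃ κ₁ : ℝ, 0 < κ₁ ∧ ∃ εbar : ℝ, 0 < εbar ∧ εbar ≤ 1 ∧ ∀ ε₀ : ℝ, 0 < ε₀ → ε₀ ≤ εbar → ∀ ν : ℝ, 0 < ν → ∀ α : Fin 4 → Fin 4 → Fin 4 → ℤ × ℤ × ℤ → ℝ, Literature.Analysis.FluidPDE.TaoCascade.InTableClass R α → (∀ (Y : Fin 4 → ℤ → ℝ → ℝ) (τ : ℝ), (∀ (j : Fin 4) (k : ℤ), 1 ≤ k → 0 ≤ Y j k τ) → ∀ δ : ℝ, 0 < δ → ∀ (i : Fin 4) (n : ℤ), 1 ≤ n → Y i n τ = 0 → 0 ≤ Literature.Analysis.FluidPDE.TaoCascade.quadTerm δ α Y i n τ) → ∃ S : Finset (Fin 4), (∀ i, i ∉ S → ∀ j l : Fin 4, α i j l (0, 0, 1) = 0) ∧ ∀ (X₀ : Fin 4 → ℝ) (s : ℝ), 0 < s → ∀ X : Fin 4 → ℤ → ℝ → ℝ, (∀ (i : Fin 4) (k : ℤ), X i k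 0 = if k = 0 then X₀ i else 0) → (∀ (i : Fin 4) (k : ℤ), k < 0 → ∀ t : ℝ, X i k t = 0) → (∃ M : ℝ, ∀ (t : ℝ) (i : Fin 4) (k : ℤ), (1 + (1 + ε₀) ^ ((10 : ℝ) * k)) * |X i k t| ≤ M) → (∀ (i : Fin 4) (k : ℤ), Continuous (X i k)) → (∀ (i : Fin 4) (k : ℤ), ∀ t ∈ Set.Icc (0 : ℝ) s, HasDerivWithinAt (X i k) (Literature.Analysis.FluidPDE.TaoCascade.quadTerm ε₀ α X i k t - ν * (1 + ε₀) ^ ((2 : ℝ) * k) * X i k t) (Set.Icc (0 : ℝ) s) t) → (∀ t ∈ Set.Icc (0 : ℝ) s, ∀ (i : Fin 4) (k : ℤ), 1 ≤ k → 0 ≤ X i k t) → ∀ n : ℕ, κ₁ ≤ ε₀ * n → ∀ t ∈ Set.Icc (0 : ℝ) s, ∃ u ∈ Set.Icc (0 : ℝ) t, (∑' j : ℕ, ∑ i ∈ S, (1 / 2 : ℝ) * X i ((n + 1 : ℕ) + (j : ℤ)) t ^ 2) ≤ (1 + ε₀) ^ (-(1 + η)) * (∑' j : ℕ, ∑ i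 ∈ S, (1 / 2 : ℝ) * X i ((n : ℕ) + (j : ℤ)) u ^ 2)

/-- item stmt-NavierStokesRegularity-24642 · support · rank 9 · closed · proved by Summit.NavierStokesRegularity.NavierStokesRegularity.Theorems.orthantInvariance_proof (prover) · by planner
why it might fail: no mathematical risk foreseen (closed-cone invariance for a locally Lipschitz field in the weighted sup-norm space given the (4.5) bound); formal cost = Nagumo/Kamke for an infinite system.
sources: Cheskidov2008, BarbatoMorandinRomito2011, arXiv:1201.2693
[support] KNOWN-TYPE (Kamke quasi-positivity / Cheskidov positivity, generalised from the dyadic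
member to orthant tables): a regular solution of the ν-viscous lattice of an orthant table from a
one-shell datum at shell 0 is componentwise ≥ 0 on every shell k ≥ 1 for all times of its window
(the datum shell may be signed: feeds into shell 1 are sign-blind squares). [difficulty: M] -/
@[route_item "route-NavierStokesRegularity-OrthantWake"]
def OrthantInvariance : Prop :=
  ∀ ε₀ ν : ℝ, 0 < ε₀ → 0 < ν → ∀ α : Fin 4 → Fin 4 → Fin 4 → ℤ × ℤ × ℤ → ℝ, (∀ (Y : Fin 4 → ℤ → ℝ → ℝ) (τ : ℝ), (∀ (j : Fin 4) (k : ℤ), 1 ≤ k → 0 ≤ Y j k τ) → ∀ δ : ℝ, 0 < δ → ∀ (i : Fin 4) (n : ℤ), 1 ≤ n → Y i n τ = 0 → 0 ≤ Literature.Analysis.FluidPDE.TaoCascade.quadTerm δ α Y i n τ) → ∀ (X₀ : Fin 4 → ℝ) (s : ℝ), 0 < s → ∀ X : Fin 4 → ℤ → ℝ → ℝ, (∀ (i : Fin 4) (k : ℤ), X i k 0 = if k = 0 then X₀ i else 0) → (∀ (i : Fin 4) (k : ℤ), k < 0 → ∀ t : ℝ, X i k t = 0) → (∃ M : ℝ,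 ∀ (t : ℝ) (i : Fin 4) (k : ℤ), (1 + (1 + ε₀) ^ ((10 : ℝ) * k)) * |X i k t| ≤ M) → (∀ (i : Fin 4) (k : ℤ), Continuous (X i k)) → (∀ (i : Fin 4) (k : ℤ), ∀ t ∈ Set.Icc (0 : ℝ) s, HasDerivWithinAt (X i k) (Literature.Analysis.FluidPDE.TaoCascade.quadTerm ε₀ α X i k t - ν * (1 + ε₀) ^ ((2 : ℝ) * k) * X i k t) (Set.Icc (0 : ℝ) s) t) → (∀ t ∈ Set.Icc (0 : ℝ) s, ∀ (i : Fin 4) (k : ℤ), 1 ≤ k → 0 ≤ X i k t)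

-- `OrthantInvariance` holds: proved by `Summit.NavierStokesRegularity.NavierStokesRegularity.Theorems.orthantInvariance_proof` (its module imports this route file, so no `_holds` link can be stated here).

/-- item stmt-NavierStokesRegularity-27001 · crux · rank 4 · closed · proved by Summit.NavierStokesRegularity.NavierStokesRegularity.Theorems.kpBreakOfBlockWake_proof (prover) · by planner
why it might fail: Low formal risk: block induction on n₀ + jL with running maxima (monotone in t), residues r < L via monotonicity of tails in n, continuity/summability of T⁺_n from the (4.5) weight bound, tsum vs the finite partial sums of ForwardSourceSmoothing, the cast (n + L : ℕ).
sources: tree:Theorems/OrthantWakeOrthantBreakOfWake.lean, tree:Theorems/SubcriticalEnvelopeForwardSourceSmoothingFar.lean, BarbatoMorandinRomito2011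
[crux] GLUE WITH CONTENT (rank 4; replaces ForwardBreakOfWake stmt-26443, whose hypothesis
ForwardHopWake is numerically false and which therefore leaves the cone): KPBlockWake and
OrthantInvariance and ForwardSourceSmoothing imply the KP conjunct of the rung target — ∀ R ≥ 1 ∃ εR
> 0 ∀ ε₀ ≤ εR ∀ orthant diagonal-feed α ∈ E₂(R) ∀ X₀, ¬NoGlobalCascade ε₀ α X₀ (the diagonal-feed
hypothesis is only passed through to KPBlockWake). Proof plan = the landed
`orthantBreakOfWake_proof` (Theorems/OrthantWakeOrthantBreakOfWake.lean) with T replaced by T⁺ and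
the induction run on the arithmetic progressions n₀ + jL: energy monotonicity bounds every
forward-source tail by E₀; the block ratchet iterated on running maxima gives T⁺_{n₀+jL} ≤
E₀(1+ε₀)^{−(1+η)Lj}, and monotonicity of tails in n fills the residues r < L, so T⁺_m ≤
E₀(1+ε₀)^{(1+η)(κ₁/ε₀+L+1)}(1+ε₀)^{−(1+η)m} ≤ E₀ e^{(1+η)κ₁} 2^{(1+η)(L+1)} (1+ε₀)^{−(1+η)m} for ε₀
≤ 1 — a ν-uniform, sub-window-uniform envelope with rate 1+η > 1 and a constant depending on (η, κ₁,
L) only; that is the hypothesis of ForwardSourceSmoothing (stmt-26374, PROVED: Theorems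
forwardSourceSmoothing_proof) at each ν = κ/√2 with the same S, giving ViscousGlobal; t -/
@[route_item "route-NavierStokesRegularity-OrthantWake"]
def KPBreakOfBlockWake : Prop :=
  KPBlockWake → OrthantInvariance → ForwardSourceSmoothing → ∀ R : ℝ, 1 ≤ R → ∃ εR : ℝ, 0 < εR ∧ ∀ ε₀ : ℝ, 0 < ε₀ → ε₀ ≤ εR → ∀ (α : Fin 4 → Fin 4 → Fin 4 → ℤ × ℤ × ℤ → ℝ) (X₀ : Fin 4 → ℝ), Literature.Analysis.FluidPDE.TaoCascade.InTableClass R α → (∀ (Y : Fin 4 → ℤ → ℝ → ℝ) (τ : ℝ), (∀ (j : Fin 4) (k : ℤ), 1 ≤ k → 0 ≤ Y j k τ) → ∀ δ : ℝ, 0 < δ → ∀ (i : Fin 4) (n : ℤ), 1 ≤ n → Y i n τ = 0 → 0 ≤ Literature.Analysis.FluidPDE.TaoCascade.quadTerm δ α Y i n τ) → (∀ a b i : Fin 4, a ≠ b → α a b i (0, 0, 1) = 0) → ¬ Literature.Analysis.FluidPDE.TaoCascade.NoGlobalCascade ε₀ α X₀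

-- `KPBreakOfBlockWake` holds: proved by `Summit.NavierStokesRegularity.NavierStokesRegularity.Theorems.kpBreakOfBlockWake_proof` (its module imports this route file, so no `_holds` link can be stated here).

/-- item stmt-NavierStokesRegularity-24641 · aside · rank 4 · closed · proved by Summit.NavierStokesRegularity.NavierStokesRegularity.Theorems.orthantBreakOfWake_proof (prover) · by planner
why it might fail: low formal risk but real work: the running-maximum induction over n needs T_n continuous in t and summable (from the (4.5) weight bound), the envelope constant must be uniform over sub-windows [0,s] ⊆ [0,T], and signed datum shells must be absorbed into C.
sources: BarbatoMorandinRomito2011, arXiv:1402.0290, tree:Literature.Analysis.FluidPDE.Tao2016AveragedNS.ViscousEnvelopeSmoothing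
[crux] GLUE WITH CONTENT: OrthantHopWake and OrthantInvariance imply the orthant conjunct of the
rung target — for every R ≥ 1 there is εR > 0 (εR = ε̄ will do) such that for ε₀ ≤ εR every orthant
table α ∈ E₂(R) and every datum X₀ have ¬NoGlobalCascade ε₀ α X₀: energy monotonicity bounds the
first ⌈κ₁/ε₀⌉ tails by E₀ and the ratchet iterates on running maxima to T_n ≤
E₀(1+ε₀)^((1+η)(κ₁/ε₀+1))·(1+ε₀)^(−(1+η)n), which is the hypothesis of
`exists_viscousGlobal_of_subcriticalEnvelope_of_inTableClass` (ν = κ/√2); then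
`hasGlobal_of_viscousGlobal`, `hasGlobal_mono` and `noGlobalCascade_iff_kappa`. [deps:
OrthantHopWake, OrthantInvariance] [difficulty: L] -/
@[route_item "route-NavierStokesRegularity-OrthantWake"]
def OrthantBreakOfWake : Prop :=
  OrthantHopWake → OrthantInvariance → ∀ R : ℝ, 1 ≤ R → ∃ εR : ℝ, 0 < εR ∧ ∀ ε₀ : ℝ, 0 < ε₀ → ε₀ ≤ εR → ∀ (α : Fin 4 → Fin 4 → Fin 4 → ℤ × ℤ × ℤ → ℝ) (X₀ : Fin 4 → ℝ), Literature.Analysis.FluidPDE.TaoCascade.InTableClass R α → (∀ (Y : Fin 4 → ℤ → ℝ → ℝ) (τ : ℝ), (∀ (j : Fin 4) (k : ℤ), 1 ≤ k → 0 ≤ Y j k τ) → ∀ δ : ℝ, 0 < δ → ∀ (i : Fin 4) (n : ℤ), 1 ≤ n → Y i n τ = 0 → 0 ≤ Literature.Analysis.FluidPDE.TaoCascade.quadTerm δ α Y i n τ) → ¬ Literature.Analysis.FluidPDE.TaoCascade.NoGlobalCascade ε₀ α X₀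

-- `OrthantBreakOfWake` holds: proved by `Summit.NavierStokesRegularity.NavierStokesRegularity.Theorems.orthantBreakOfWake_proof` (its module imports this route file, so no `_holds` link can be stated here).

/-- item stmt-NavierStokesRegularity-26443 · aside · rank 4 · closed · proved by Summit.NavierStokesRegularity.NavierStokesRegularity.Theorems.forwardBreakOfWake_proof (prover) · by planner
why it might fail: Low formal risk but real work: T⁺_n must be continuous and summable (from the (4.5) weight bound), the running-maximum induction uniform over sub-windows [0,s] ⊆ [0,T] and over ν, and the tsum ratchet matched to the partial sums Σ_{k=n..N} of the smoothing hypothesis.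
sources: tree:Theorems/OrthantWakeOrthantBreakOfWake.lean, BarbatoMorandinRomito2011, tree:Literature.Analysis.FluidPDE.Tao2016AveragedNS.ViscousEnvelopeSmoothing
[crux] GLUE WITH CONTENT (rank 4; replaces OrthantBreakOfWake stmt-24641, proved for the
total-energy ratchet and now outside the cone): ForwardHopWake and OrthantInvariance and
ForwardSourceSmoothing imply the ORTHANT conjunct of the rung target — ∀ R ≥ 1 ∃ εR > 0 ∀ ε₀ ≤ εR ∀
orthant α ∈ E₂(R) ∀ X₀, ¬NoGlobalCascade ε₀ α X₀. Proof plan = the landed `orthantBreakOfWake_proof`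
(Theorems/OrthantWakeOrthantBreakOfWake.lean) with T replaced by T⁺: energy monotonicity bounds the
first ⌈κ₁/ε₀⌉ forward-source tails by E₀; the ratchet iterates on running maxima of T⁺ to the
sub-window-uniform, ν-uniform envelope T⁺_n ≤ E₀(1+ε₀)^{(1+η)(κ₁/ε₀+1)}(1+ε₀)^{−(1+η)n}; that is the
hypothesis of ForwardSourceSmoothing at each ν = κ/√2 (same S), giving ViscousGlobal; then
`hasGlobal_of_viscousGlobal`, `hasGlobal_mono`, `noGlobalCascade_iff_kappa`. why it might fail: low
formal risk; the running-maximum induction needs T⁺_n continuous and summable (from the (4.5) weight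
bound) and the partial sums Σ_{k=n..N} of the smoothing hypothesis matched against the tsum of the
ratchet. sources: tree:Theorems/OrthantWakeOrthantBreakOfWake.lean; BarbatoMorandinRomito2011;
tree:Literature.Analysis.FluidPDE.Tao201 -/
@[route_item "route-NavierStokesRegularity-OrthantWake"]
def ForwardBreakOfWake : Prop :=
  ForwardHopWake → OrthantInvariance → ForwardSourceSmoothing → ∀ R : ℝ, 1 ≤ R → ∃ εR : ℝ, 0 < εR ∧ ∀ ε₀ : ℝ, 0 < ε₀ → ε₀ ≤ εR → ∀ (α : Fin 4 → Fin 4 → Fin 4 → ℤ × ℤ × ℤ → ℝ) (X₀ : Fin 4 → ℝ), Literature.Analysis.FluidPDE.TaoCascade.InTableClass R α → (∀ (Y : Fin 4 → ℤ → ℝ → ℝ) (τ : ℝ), (∀ (j : Fin 4) (k : ℤ), 1 ≤ k → 0 ≤ Y j k τ) → ∀ δ : ℝ, 0 < δ → ∀ (i : Fin 4) (n : ℤ), 1 ≤ n → Y i n τ = 0 → 0 ≤ Literature.Analysis.FluidPDE.TaoCascade.quadTerm δ α Y i n τ) → ¬ Literature.Analysis.FluidPDE.TaoCascade.NoGlobalCascade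 ε₀ α X₀

-- `ForwardBreakOfWake` holds: proved by `Summit.NavierStokesRegularity.NavierStokesRegularity.Theorems.forwardBreakOfWake_proof` (its module imports this route file, so no `_holds` link can be stated here).

/-- item stmt-NavierStokesRegularity-24644 · aside · rank 9 · open · by planner
why it might fail: open in print: BMR's invariant region is certified at ratio 2 only
sources: arXiv:1506.07480, arXiv:1007.3401, arXiv:2209.10203
ASIDE (banked context, never staffed): the S-restricted case named for the tribunal's T3 — the
orthant conjunct for the ONE-MODE member (dyadic table) strictly below ε₀ = 1 (shell ratio < 2 in
BMR normalisation); open in print (arXiv:1506.07480 p. 3, arXiv:2209.10203 §3.2); the BC5 witness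
`not_noGlobalCascade_one_dyadicTable` is the ε₀ = 1 case. -/
@[route_item "route-NavierStokesRegularity-OrthantWake"]
def DyadicBreakBelowOne : Prop :=
  ∀ ε₀ : ℝ, 0 < ε₀ → ε₀ < 1 → ∀ X₀ : Fin 4 → ℝ, ¬ Literature.Analysis.FluidPDE.TaoCascade.NoGlobalCascade ε₀ Literature.Analysis.FluidPDE.TaoCascade.dyadicTable X₀

/-- item stmt-NavierStokesRegularity-24643 · assembly · rank 1 · closed · proved by Summit.NavierStokesRegularity.NavierStokesRegularity.Theorems.orthantWake_assembly_proof (prover) · by planner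
sources: arXiv:1402.0290, Literature.Analysis.FluidPDE.Tao2016AveragedNS.ViscousEnvelopeSmoothing
[assembly] OrthantHopWake → OrthantInvariance → OrthantBreakOfWake → NonOrthantBreak → rung target
TaoLadderRungTwoBreak.Target. -/
@[route_item "route-NavierStokesRegularity-OrthantWake"]
def Assembly : Prop :=
  OrthantHopWake → OrthantInvariance → OrthantBreakOfWake → NonOrthantBreak → Summit.NavierStokesRegularity.NavierStokesRegularity.Theses.TaoLadderRungTwoBreak.Target

-- `Assembly` holds: proved by `Summit.NavierStokesRegularity.NavierStokesRegularity.Theorems.orthantWake_assembly_proof` (its module imports this route file, so no `_holds` link can be stated here).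

/-! D-0027 §2.1 — DECIDING THEOREM (planner-authored via `route open/edit --closes-file`; by planner-ns-idea-1-g5-0 2026-08-28T08:51:30Z):
its hypotheses are this route's items and its conclusion the registered leaf `Summit.NavierStokesRegularity.NavierStokesRegularity.Theses.TaoLadderRungTwoBreak.Target` (rung TL-M2Break, D-0061) (glue_lint), and it elaborates with this file. -/

@[closes "route-NavierStokesRegularity-OrthantWake"] theorem closes (h1 : KPBlockWake) (h2 : OrthantInvariance) (hB : ForwardSourceSmoothing)
    (h3 : KPBreakOfBlockWake) (h5 : NonDiagonalOrthantBreak) (h4 : NonOrthantBreak) :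
    Summit.NavierStokesRegularity.NavierStokesRegularity.Theses.TaoLadderRungTwoBreak.Target := by
  intro R hR
  obtain ⟨ε₁, hε₁, H1⟩ := h3 h1 h2 hB R hR
  obtain ⟨ε₃, hε₃, H3⟩ := h5 R hR
  obtain ⟨ε₂, hε₂, H2⟩ := h4 R hR
  refine ⟨min ε₁ (min ε₃ ε₂), lt_min hε₁ (lt_min hε₃ hε₂), ?_⟩
  intro ε₀ h0 hle α X₀ hα
  by_cases hO : (∀ (Y : Fin 4 → ℤ → ℝ → ℝ) (τ : ℝ), (∀ (j : Fin 4) (k : ℤ), 1 ≤ k → 0 ≤ Y j k τ) → ∀ δ : ℝ, 0 < δ → ∀ (i : Fin 4) (n : ℤ), 1 ≤ n → Y i n τ = 0 → 0 ≤ Literature.Analysis.FluidPDE.TaoCascade.quadTerm δ α Y i n τ)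
  · by_cases hD : (∀ a b i : Fin 4, a ≠ b → α a b i (0, 0, 1) = 0)
    · exact H1 ε₀ h0 (hle.trans (min_le_left _ _)) α X₀ hα hO hD
    · exact H3 ε₀ h0 ((hle.trans (min_le_right _ _)).trans (min_le_left _ _)) α X₀ hα hO hD
  · exact H2 ε₀ h0 ((hle.trans (min_le_right _ _)).trans (min_le_right _ _)) α X₀ hα hO

end Summit.NavierStokesRegularity.NavierStokesRegularity.Theses.OrthantWake
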